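import Summits.ValiantsHypothesis.ValiantsHypothesis.Theorems.GrenetZeonDualUnipotentThreeHalvesNilpotentPencilCore

/-!
# val-idea-26 g4 (crux `stmt-ValiantsHypothesis-24318`, R2 `HeavyTopLaw`; card `nil-core` §F4) — RANK-ONE RETURNS

Kernel form of the «no-return lemma» (critic price P10-4 (R2)) in its EXACT version, plus the isotropy mechanism of the
SKEW-CORNER family (MEMO-g4-skewcorner.md).

* `vecMulVec_sandwich` — `(u wᵀ) X (u wᵀ) = (wᵀ X u) · u wᵀ`.
* `pow_succ_add_smul_of_sandwich` — if `Λ gʲ Λ = 0` for all `j` then `(g + tΛ)^(k+1) = g^(k+1) + t Σ_{i+j=k} gⁱ Λ gʲ`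
  (the pencil through a «sandwich-null» direction is LINEAR in `t` power by power).
* ★ `isNilpotent_add_smul_vecMulVec` — RANK-ONE RETURN CRITERION (⇐): `g` nilpotent and `wᵀ gʲ u = 0 ∀ j`
  ⇒ `g + t·u wᵀ` nilpotent for every `t`;  ★ `dotProduct_pow_mulVec_eq_zero_of_pencil` — (⇒), by trace isotropy
  (✓ `trace_pow_mul_eq_zero_of_pencil`, MOR 1991 Lemma 2);  ★ `nilSpace_sup_span_vecMulVec_iff` — the space version:
  for a space `G` of nilpotent matrices, `G ⊕ ℂ·u wᵀ` consists of nilpotents iff `wᵀ gʲ u = 0` for all `g ∈ G`, `j ≥ 0`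
  (full corner isotropy).  So a rank-one RETURN can be glued to a core exactly along a totally corner-isotropic core.
* `transpose_pow_mul_of_jordan` / `dotProduct_mulVec_self_of_skew` / ★ `corner_isotropy_of_jordan` — if `Tᵀ = −T` and
  `M T = T Mᵀ` (i.e. `M` is self-adjoint for the skew form `T`), then every `Mᵃ T` is skew, hence `ρᵀ Mᵃ T ρ = 0`:
  the corner entries of all powers of the skew-corner matrices `[[0,ρ,0],[0,M,Tρᵀ],[0,0,0]]` vanish, which with the
  criterion above makes `W(T) = {those} ⊕ ℂ·E_{m1}` a nilpotent space (irreducible of dim ⌊(m−1)²/4⌋+1 for `T`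
  non-degenerate, numerics m ≤ 20 in the memo) — a ONE-RETURN monolith with a RANK-ONE return.

Honest framing: helper lemmas for the crux dossier only; nothing here asserts `HeavyTopLaw`, `IndexCoreLaw`, the crux,
rung 8062 or VP ≠ VNP (NOT proved).  Mathlib + one tree import.  [val-idea-26 g4; MOR 1991 Lemmas 1–2 for (⇒)]
-/

namespace Summit.ValiantsHypothesis.ValiantsHypothesis.Cruxes.DualUnipotentThreeHalves.SkewCorner

open Matrix
open Finset.HasAntidiagonal (antidiagonal mem_antidiagonal)
open Summit.ValiantsHypothesis.ValiantsHypothesis.Theorems.GrenetZeon.RadicalSplit (trace_pow_mul_eq_zero_of_pencil)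

variable {m : ℕ}

/-- Sandwich identity for a rank-one matrix: `(u wᵀ) X (u wᵀ) = (wᵀ X u) · (u wᵀ)`. -/
theorem vecMulVec_sandwich (u w : Fin m → ℂ) (X : Matrix (Fin m) (Fin m) ℂ) :
    vecMulVec u w * X * vecMulVec u w = (w ⬝ᵥ X *ᵥ u) • vecMulVec u w := by
  rw [Matrix.mul_assoc, mul_vecMulVec, vecMulVec_mul_vecMulVec, vecMulVec_smul]

/-- If the direction `Λ` is «sandwich-null» along `g` (`Λ gʲ Λ = 0` for all `j`), the powers of the pencil `g + tΛ`
are LINEAR in `t`: `(g + tΛ)^(k+1) = g^(k+1) + t · Σ_{i+j=k} gⁱ Λ gʲ`. -/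
theorem pow_succ_add_smul_of_sandwich (g Λ : Matrix (Fin m) (Fin m) ℂ) (hΛ : ∀ j : ℕ, Λ * g ^ j * Λ = 0) (t : ℂ) :
    ∀ k : ℕ, (g + t • Λ) ^ (k + 1) =
      g ^ (k + 1) + t • ∑ p ∈ antidiagonal k, g ^ p.1 * Λ * g ^ p.2
  | 0 => by simp
  | k + 1 => by
    rw [pow_succ, pow_succ_add_smul_of_sandwich g Λ hΛ t k, Finset.Nat.sum_antidiagonal_succ']
    have hkill : (∑ p ∈ antidiagonal k, g ^ p.1 * Λ * g ^ p.2) * Λ = 0 := by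
      rw [Finset.sum_mul]
      refine Finset.sum_eq_zero fun p _ => ?_
      rw [Matrix.mul_assoc (g ^ p.1 * Λ), Matrix.mul_assoc (g ^ p.1), ← Matrix.mul_assoc Λ, hΛ, Matrix.mul_zero]
    have hshift : (∑ p ∈ antidiagonal k, g ^ p.1 * Λ * g ^ p.2) * g =
        ∑ p ∈ antidiagonal k, g ^ p.1 * Λ * g ^ (p.2 + 1) := by
      rw [Finset.sum_mul]
      refine Finset.sum_congr rfl fun p _ => ?_
      rw [Matrix.mul_assoc, ← pow_succ]
    rw [add_mul, mul_add, mul_add]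
    simp only [mul_smul_comm, smul_mul_assoc, hkill, hshift, smul_zero, add_zero, pow_zero, Matrix.mul_one,
      smul_add, ← pow_succ]
    abel

/-- ★ **RANK-ONE RETURN CRITERION, sufficiency.**  If `g` is nilpotent and totally corner-isotropic for `(w, u)`
(`wᵀ gʲ u = 0` for all `j ≥ 0`), then `g + t · u wᵀ` is nilpotent for every `t`. -/
theorem isNilpotent_add_smul_vecMulVec (g : Matrix (Fin m) (Fin m) ℂ) (u w : Fin m → ℂ) (hg : IsNilpotent g)
    (hiso : ∀ j : ℕ, w ⬝ᵥ (g ^ j) *ᵥ u = 0) (t : ℂ) : IsNilpotent (g + t • vecMulVec u w) := by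
  obtain ⟨N, hN⟩ := hg
  have hΛ : ∀ j : ℕ, vecMulVec u w * g ^ j * vecMulVec u w = 0 := fun j => by
    rw [vecMulVec_sandwich, hiso, zero_smul]
  refine ⟨2 * N + 1, ?_⟩
  rw [pow_succ_add_smul_of_sandwich g _ hΛ t (2 * N)]
  have h1 : g ^ (2 * N + 1) = 0 := by
    rw [pow_succ, pow_mul, pow_right_comm] ; simp [hN]
  have h2 : ∑ p ∈ antidiagonal (2 * N), g ^ p.1 * vecMulVec u w * g ^ p.2 = 0 := by
    refine Finset.sum_eq_zero fun p hp => ?_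
    rw [mem_antidiagonal] at hp
    rcases le_or_gt N p.1 with h | h
    · rw [← Nat.add_sub_cancel' h, pow_add, hN, Matrix.zero_mul, Matrix.zero_mul, Matrix.zero_mul]
    · have h' : N ≤ p.2 := by omega
      rw [← Nat.add_sub_cancel' h', pow_add, hN, Matrix.zero_mul, Matrix.mul_zero]
  rw [h1, h2, smul_zero, add_zero]

/-- ★ **RANK-ONE RETURN CRITERION, necessity (char 0).**  If `g + t · u wᵀ` is nilpotent for every `t`, then
`wᵀ gʲ u = 0` for all `j` — by trace isotropy of nilpotent pencils (✓ `trace_pow_mul_eq_zero_of_pencil`). -/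
theorem dotProduct_pow_mulVec_eq_zero_of_pencil (g : Matrix (Fin m) (Fin m) ℂ) (u w : Fin m → ℂ)
    (h : ∀ t : ℂ, IsNilpotent (g + t • vecMulVec u w)) (j : ℕ) : w ⬝ᵥ (g ^ j) *ᵥ u = 0 := by
  have := trace_pow_mul_eq_zero_of_pencil g (vecMulVec u w) h j
  rwa [mul_vecMulVec, trace_vecMulVec, dotProduct_comm] at this

/-- ★ **THE SPACE VERSION.**  For a space `G` of nilpotent matrices and a rank-one `Λ = u wᵀ`: every element of
`G + ℂΛ` is nilpotent iff `G` is totally corner-isotropic for `(w, u)`.  (For `Λ = E_{m1}` over a core `G ⊆ 𝔫_m`: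
iff the `(1,m)` entries of all powers of all `g ∈ G` vanish — the RETURN `e₁ ↦ e_m` closes no cycle.) -/
theorem nilSpace_sup_span_vecMulVec_iff (G : Submodule ℂ (Matrix (Fin m) (Fin m) ℂ)) (hG : ∀ g ∈ G, IsNilpotent g)
    (u w : Fin m → ℂ) :
    (∀ A ∈ G ⊔ ℂ ∙ vecMulVec u w, IsNilpotent A) ↔ ∀ g ∈ G, ∀ j : ℕ, w ⬝ᵥ (g ^ j) *ᵥ u = 0 := by
  constructor
  · intro h g hg j
    refine dotProduct_pow_mulVec_eq_zero_of_pencil g u w (fun t => h _ ?_) j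
    exact Submodule.add_mem_sup hg (Submodule.smul_mem _ t (Submodule.mem_span_singleton_self _))
  · intro h A hA
    obtain ⟨g, hg, Λ', hΛ', rfl⟩ := Submodule.mem_sup.1 hA
    obtain ⟨t, rfl⟩ := Submodule.mem_span_singleton.1 hΛ'
    exact isNilpotent_add_smul_vecMulVec g u w (hG g hg) (h g hg) t

/-! ## The isotropy mechanism of the skew-corner family: Jordan algebra of a skew form -/

variable {q : ℕ}

/-- Powers of a `T`-self-adjoint matrix stay `T`-self-adjoint: `Mᵃ T = T (Mᵃ)ᵀ`. -/
theorem pow_mul_eq_mul_transpose_pow (T M : Matrix (Fin q) (Fin q) ℂ) (hM : M * T = T * Mᵀ) :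
    ∀ a : ℕ, M ^ a * T = T * (M ^ a)ᵀ
  | 0 => by simp
  | a + 1 => by
    calc M ^ (a + 1) * T = M ^ a * (M * T) := by rw [pow_succ, Matrix.mul_assoc]
      _ = M ^ a * T * Mᵀ := by rw [hM, Matrix.mul_assoc]
      _ = T * ((M ^ a)ᵀ * Mᵀ) := by rw [pow_mul_eq_mul_transpose_pow T M hM a, Matrix.mul_assoc]
      _ = T * (M ^ (a + 1))ᵀ := by rw [← transpose_mul, ← pow_succ']

/-- If `T` is skew and `M` is `T`-self-adjoint then every `Mᵃ T` is skew. -/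
theorem transpose_pow_mul_of_jordan (T M : Matrix (Fin q) (Fin q) ℂ) (hT : Tᵀ = -T) (hM : M * T = T * Mᵀ)
    (a : ℕ) : (M ^ a * T)ᵀ = -(M ^ a * T) := by
  rw [transpose_mul, hT, pow_mul_eq_mul_transpose_pow T M hM a, transpose_pow]
  simp

/-- A skew matrix has identically vanishing quadratic form (char ≠ 2). -/
theorem dotProduct_mulVec_self_of_skew (S : Matrix (Fin q) (Fin q) ℂ) (hS : Sᵀ = -S) (ρ : Fin q → ℂ) :
    ρ ⬝ᵥ S *ᵥ ρ = 0 := by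
  have h : ρ ⬝ᵥ S *ᵥ ρ = -(ρ ⬝ᵥ S *ᵥ ρ) := by
    conv_lhs => rw [dotProduct_mulVec, ← mulVec_transpose, hS, dotProduct_comm]
    simp [Matrix.neg_mulVec]
  linear_combination h / 2

/-- ★ **CORNER ISOTROPY OF THE SKEW-CORNER FAMILY.**  `Tᵀ = −T`, `M T = T Mᵀ` ⇒ `ρᵀ Mᵃ T ρ = 0` for all `a`:
the `(top, bottom)` entries of all powers of `[[0,ρ,0],[0,M,Tρᵀ],[0,0,0]]` vanish, so by
`nilSpace_sup_span_vecMulVec_iff` the return `E_{m1}` can be glued. -/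
theorem corner_isotropy_of_jordan (T M : Matrix (Fin q) (Fin q) ℂ) (hT : Tᵀ = -T) (hM : M * T = T * Mᵀ)
    (ρ : Fin q → ℂ) (a : ℕ) : ρ ⬝ᵥ (M ^ a * T) *ᵥ ρ = 0 :=
  dotProduct_mulVec_self_of_skew _ (transpose_pow_mul_of_jordan T M hT hM a) ρ

end Summit.ValiantsHypothesis.ValiantsHypothesis.Cruxes.DualUnipotentThreeHalves.SkewCorner
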